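import Summits.NavierStokesRegularity.FluidComputer.PalasekTowerLineCrossing
import Summits.NavierStokesRegularity.FluidComputer.PalasekTowerHeredityWitnessCalibration

/-!
# REGISTER v2.3′: the a-priori ceiling from a RATE bound on the pressure push (dual line crossing)

Cell `ns-blowup`, seat `ns-blowup-fc-prover-3` (g3; prover; D-0074 GROUP C/E «BRIDGE SUPPORT»;
bears_on LADDER-NS N1, route `PalasekTowerBreakdown`, child crux items stmt-NavierStokesRegularity-19249
`HeredityAtOne` (upper stub `ContinuationEnvelopeAt 1 ↔ AprioriCeilingAt 1`, p442648) and -19250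
`HeredityFromTwo` (upper half `AprioriCeiling`) — supports only, nothing claimed or closed). Companion of
`PalasekTowerLineCrossing.lean`; the DUAL of `PalasekTowerHandoverPressureRate.lean` and the rate form of
this seat's p441906/p442281 `PalasekTowerOvershootFirstHitting.lean`. LABEL: E–C typing (KERNEL
analysis; every statement PROVED; no `Prop` introduced; no unproved fact). WHAT THIS IS NOT: not
Navier–Stokes evidence — nothing is constructed; the stubs `AprioriCeilingAt k` / `AprioriCeiling` are
neither proved nor refuted; the theorems give SUFFICIENT CONDITIONS for them in terms of a rate.

## What is proved

* `Stage.exists_lineCrossing_continuation` — a finite-energy classical continuation of a registered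
  stage (`k ≥ 1`, quiet schedule, `ν > 0`) that reaches a level `B` at `T₂ ≥ τ_k` first crosses every
  line through `(T₂, B)` of slope `Λ (T₂ − τ_k) < B − c₂ Y_k` at a force-free pressure-driven global
  argmax: `ν|Du|²_F + ⟪u, ∇p⟫ + Λ‖u‖ ≤ 0`.
* `Stage.norm_le_ceiling_of_pressureRate` — NO OVERSHOOT of `c₂ Y_{k+1}` on `[0, T'] ⊆ [0, τ_{k+1}]`
  if at every running global speed maximum in the band `(c₂ Y_k, c₂ Y_{k+1}]` exceeding all earlier
  speeds `−⟪u, ∇p⟫ < ν|Du|²_F + Λ_k' ‖u‖`, `Λ_k' := c₂ (Y_{k+1} − Y_k)/(τ_{k+1} − τ_k)` (an overshoot before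
  `τ_{k+1}` is strictly faster than the line from `(τ_k, c₂ Y_k)` to `(τ_{k+1}, c₂ Y_{k+1})`).
* `aprioriCeilingAt_of_pressureRate` (`k ≥ 1`) / `aprioriCeiling_of_pressureRate` (all `k ≥ 2`): the
  upper-half stubs from the RATE bound — strictly weaker hypotheses than the SIGN condition
  `0 < |Du|²_F + ⟪u, ∇p⟫` at first touchings of `c₂ Y_{k+1}` (p442281 `aprioriCeilingAt_of_noPush`): the
  pressure may push, as long as it pushes slowly. Number of record at `k = 1` (item 19249):
  `Λ₁' = (5/3)(Y₂ − Y₁)/(τ₂ − τ₁) ∈ (1.021, 1.022)·10⁸` (`Schedule.Rigid.overshootRate_one_bounds`), and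
  `aprioriCeilingAt_one_of_pressureRate_num` (the stub from the bound with the numeral `1.021·10⁸`).

References: S. Palasek, arXiv:2605.13827 §4 [cite: Palasek2026ElementaryModel, §4]; D. Gilbarg,
N. Trudinger, *Elliptic PDE of second order*, §3.1 [cite: GilbargTrudinger2001, §3.1]; T. Tao, Anal. PDE 6
(2013), Cor. 11.1 [cite: Tao2011, Cor. 11.1].
-/

noncomputable section

namespace Summit.NavierStokesRegularity.FluidComputer.PalasekTowerClayBridge

open Set MeasureTheory Filter Topology Function Real
open scoped ENNReal ContDiff NNReal InnerProductSpace RealInnerProductSpace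
open Laplacian
open Literature.Analysis.FluidPDE

/-! ## §5 The dual: the a-priori ceiling from a RATE bound on the pressure push -/

namespace Stage

variable {ν : ℝ} {R : TowerRates} {S : Schedule R} {m : Margins R} {k : ℕ}

/-- **LINE CROSSING BY A CONTINUATION of a registered stage** (`ν > 0`, quiet schedule, `k ≥ 1`).
Let `(u, p)` be a finite-energy classical continuation of the stage `s` to `[0, T']`, `T' ≥ τ_k`, that
reaches a level `B > 0` at some `T₂ ∈ [τ_k, T']`. For every slope `Λ` with
`Λ (T₂ − τ_k) < B − c₂ Y_k`, the line through `(T₂, B)` of slope `Λ` is first crossed at some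
`t⋆ ∈ (τ_k, T₂]`, at a global argmax, force-free, with `ν|Du|²_F + ⟪u, ∇p⟫ + Λ‖u‖ ≤ 0`.
[cite: Palasek2026ElementaryModel, §4] -/
theorem exists_lineCrossing_continuation (hν : 0 < ν) (hQ : S.Quiet) (hk : 1 ≤ k)
    (s : Stage ν R S m k) {T' : ℝ} (hT' : S.τ k ≤ T')
    {u : ℝ → EuclideanSpace ℝ (Fin 3) → EuclideanSpace ℝ (Fin 3)}
    {p : ℝ → EuclideanSpace ℝ (Fin 3) → ℝ}
    (hcl : IsClassicalNSSolutionOn (Icc 0 T') ν S.f u p)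
    (hagree : ∀ t ∈ Icc 0 (S.τ k), u t = s.u t)
    (henergy : ∃ C : ℝ≥0∞, C < ⊤ ∧ ∀ t ∈ Icc 0 T', ∫⁻ x, ‖u t x‖ₑ ^ 2 ≤ C)
    {B T₂ Λ : ℝ} (hB : 0 < B) (hT₂ : T₂ ∈ Icc (S.τ k) T') (hreach : ∃ x, B ≤ ‖u T₂ x‖)
    (hΛ : Λ * (T₂ - S.τ k) < B - S.c₂ * R.Y k) :
    ∃ t₀ ∈ Ioc (S.τ k) T₂, ∃ x₀ : EuclideanSpace ℝ (Fin 3),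
      ‖u t₀ x₀‖ = B - Λ * (T₂ - t₀) ∧
      (∀ x, ‖u t₀ x‖ ≤ ‖u t₀ x₀‖) ∧
      (∀ t ∈ Ico 0 t₀, ∀ x, ‖u t x‖ < B - Λ * (T₂ - S.τ k) + Λ * max (t - S.τ k) 0) ∧
      Λ * ‖u t₀ x₀‖ ≤ ⟪u t₀ x₀, timeDerivWithin (Icc 0 T') u t₀ x₀⟫ ∧
      ν * frobeniusNormSq (fderiv ℝ (u t₀) x₀) + ⟪u t₀ x₀, gradient (p t₀) x₀⟫ + Λ * ‖u t₀ x₀‖ ≤ 0 := by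
  have hT'0 : 0 < T' := (S.τ_pos k).trans_le hT'
  have h₀ : HasRapidSpatialDecay (u 0) := by
    rw [hagree 0 ⟨le_rfl, (S.τ_pos k).le⟩]
    exact s.hasRapidSpatialDecay_zero
  have hYk : 0 < R.Y k := Real.rpow_pos_of_pos (R.N_pos k) _
  have hc₂ : 0 < S.c₂ := s.c₂_pos
  set L₁ : ℝ := B - Λ * (T₂ - S.τ k) with hL₁def
  have hL₁A : S.c₂ * R.Y k < L₁ := by simp only [hL₁def]; linarith
  have hL₁ : 0 < L₁ := lt_trans (mul_pos hc₂ hYk) hL₁A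
  have hL₂ : 0 < L₁ + Λ * (T₂ - S.τ k) := by
    have : L₁ + Λ * (T₂ - S.τ k) = B := by simp only [hL₁def]; ring
    rw [this]; exact hB
  have hbefore : ∀ t ∈ Icc 0 (S.τ k), ∀ x, ‖u t x‖ < L₁ := fun t ht x => by
    rw [hagree t ht]; exact lt_of_le_of_lt (s.ceiling k le_rfl t ht x) hL₁A
  have hreach' : ∃ x, L₁ + Λ * (T₂ - S.τ k) ≤ ‖u T₂ x‖ := by
    obtain ⟨x, hx⟩ := hreach
    exact ⟨x, by simp only [hL₁def]; linarith⟩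
  obtain ⟨t₀, ht₀, x₀, hval, hmax, hstrict, htime, hineq⟩ :=
    exists_lineCrossing_of_clayContinuation hν hT'0 hcl h₀ S.force_smooth S.force_decay henergy
      (S.τ_pos k).le hT₂.1 hT₂.2 hL₁ hL₂ hbefore hreach'
  have hval' : ‖u t₀ x₀‖ = B - Λ * (T₂ - t₀) := by rw [hval]; simp only [hL₁def]; ring
  have h1 : S.τ 1 ≤ t₀ := (S.τ_mono hk).trans ht₀.1.le
  rw [hQ.apply h1 x₀, inner_zero_right] at hineq
  exact ⟨t₀, ht₀, x₀, hval', hmax, hstrict, htime, hineq⟩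

/-- **NO OVERSHOOT FROM A RATE BOUND ON THE PRESSURE PUSH** (`ν > 0`, quiet schedule, `k ≥ 1`, one
continuation). Let `(u, p)` be a finite-energy classical continuation of the stage `s` on `[0, T']`,
`T' ∈ [τ_k, τ_{k+1}]`, and let `Λ_k' := (c₂ Y_{k+1} − c₂ Y_k)/(τ_{k+1} − τ_k)` be the mean rate an
overshoot must achieve. If at every `t ∈ (τ_k, T']` and every global argmax `x` of `u(t, ·)` whose speed
lies in the band `(c₂ Y_k, c₂ Y_{k+1}]` and exceeds every earlier speed one has
`−⟪u, ∇p⟫ < ν|Du|²_F + Λ_k' ‖u‖`, then `‖u‖ ≤ c₂ Y_{k+1}` on `[0, T'] × ℝ³`. (Contrapositive of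
`exists_lineCrossing_continuation` with slope `Λ_k'`: an overshoot at `t ≤ τ_{k+1}` is STRICTLY faster
than the line from `(τ_k, c₂ Y_k)` to `(τ_{k+1}, c₂ Y_{k+1})`.) [cite: Palasek2026ElementaryModel, §4] -/
theorem norm_le_ceiling_of_pressureRate (hν : 0 < ν) (hQ : S.Quiet) (hk : 1 ≤ k)
    (s : Stage ν R S m k) {T' : ℝ} (hT' : T' ∈ Icc (S.τ k) (S.τ (k + 1)))
    {u : ℝ → EuclideanSpace ℝ (Fin 3) → EuclideanSpace ℝ (Fin 3)}
    {p : ℝ → EuclideanSpace ℝ (Fin 3) → ℝ}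
    (hcl : IsClassicalNSSolutionOn (Icc 0 T') ν S.f u p)
    (hagree : ∀ t ∈ Icc 0 (S.τ k), u t = s.u t)
    (henergy : ∃ C : ℝ≥0∞, C < ⊤ ∧ ∀ t ∈ Icc 0 T', ∫⁻ x, ‖u t x‖ₑ ^ 2 ≤ C)
    (h : ∀ t ∈ Ioc (S.τ k) T', ∀ x : EuclideanSpace ℝ (Fin 3),
      (∀ y, ‖u t y‖ ≤ ‖u t x‖) →
      S.c₂ * R.Y k < ‖u t x‖ → ‖u t x‖ ≤ S.c₂ * R.Y (k + 1) →
      (∀ t' ∈ Ico 0 t, ∀ y, ‖u t' y‖ < ‖u t x‖) →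
      - ⟪u t x, gradient (p t) x⟫ < ν * frobeniusNormSq (fderiv ℝ (u t) x) +
        (S.c₂ * R.Y (k + 1) - S.c₂ * R.Y k) / (S.τ (k + 1) - S.τ k) * ‖u t x‖) :
    ∀ t ∈ Icc 0 T', ∀ x, ‖u t x‖ ≤ S.c₂ * R.Y (k + 1) := by
  intro t ht x
  by_contra hgt
  have hgt' : S.c₂ * R.Y (k + 1) < ‖u t x‖ := lt_of_not_ge hgt
  set A : ℝ := S.c₂ * R.Y k with hAdef
  set B : ℝ := S.c₂ * R.Y (k + 1) with hBdef
  set w : ℝ := S.τ (k + 1) - S.τ k with hwdef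
  set Λ : ℝ := (B - A) / w with hΛdef
  have hc₂ : 0 < S.c₂ := s.c₂_pos
  have hAB : A < B := mul_lt_mul_of_pos_left (R.Y_lt_Y_succ k) hc₂
  have hB : 0 < B := mul_pos hc₂ (Real.rpow_pos_of_pos (R.N_pos (k + 1)) _)
  have hw : 0 < w := by simp only [hwdef]; linarith [S.τ_lt_succ k]
  have hΛ0 : 0 < Λ := div_pos (by linarith) hw
  have hΛw : Λ * w = B - A := div_mul_cancel₀ _ hw.ne'
  -- the overshoot happens after `τ_k`
  have hτt : S.τ k < t := by
    by_contra hle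
    have h1 := s.ceiling k le_rfl t ⟨ht.1, le_of_not_gt hle⟩ x
    rw [← hagree t ⟨ht.1, le_of_not_gt hle⟩] at h1
    exact absurd (lt_of_le_of_lt h1 hAB) (not_lt.2 hgt'.le)
  have ht0 : 0 < t := (S.τ_pos k).trans hτt
  -- by continuity the level `B` is still exceeded slightly BEFORE `t`
  have hcont : ContinuousWithinAt (fun t' => ‖u t' x‖) (Ico 0 t) t :=
    ((hcl.smooth_velocity.differentiableWithinAt_time ht x).continuousWithinAt.norm).mono
      fun t' ht' => ⟨ht'.1, ht'.2.le.trans ht.2⟩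
  haveI hne : (𝓝[Ico 0 t] t).NeBot := by
    refine mem_closure_iff_nhdsWithin_neBot.1 ?_
    rw [closure_Ico ht0.ne]
    exact right_mem_Icc.2 ht0.le
  have hev1 : ∀ᶠ t' in 𝓝[Ico 0 t] t, B < ‖u t' x‖ :=
    hcont.eventually (Ioi_mem_nhds hgt')
  have hev2 : ∀ᶠ t' in 𝓝[Ico 0 t] t, S.τ k < t' :=
    mem_nhdsWithin_of_mem_nhds (Ioi_mem_nhds hτt)
  have hev3 : ∀ᶠ t' in 𝓝[Ico 0 t] t, t' ∈ Ico 0 t := eventually_mem_nhdsWithin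
  obtain ⟨t₂, hB₂, hτt₂, ht₂⟩ := (hev1.and (hev2.and hev3)).exists
  -- line crossing with slope `Λ` ending at `(t₂, B)`, strictly admissible since `t₂ < τ_{k+1}`
  have hT₂ : t₂ ∈ Icc (S.τ k) T' := ⟨hτt₂.le, ht₂.2.le.trans ht.2⟩
  have hΛ' : Λ * (t₂ - S.τ k) < B - A := by
    have hlt : t₂ - S.τ k < w := by simp only [hwdef]; linarith [ht₂.2, ht.2, hT'.2]
    calc Λ * (t₂ - S.τ k) < Λ * w := mul_lt_mul_of_pos_left hlt hΛ0
      _ = B - A := hΛw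
  obtain ⟨t₀, ht₀, x₀, hval, hmax, hstrict, -, hineq⟩ :=
    s.exists_lineCrossing_continuation hν hQ hk hT'.1 hcl hagree henergy hB hT₂ ⟨x, hB₂.le⟩ hΛ'
  have ht₀' : t₀ ∈ Ioc (S.τ k) T' := ⟨ht₀.1, ht₀.2.trans hT₂.2⟩
  have hlow : A < ‖u t₀ x₀‖ := by
    rw [hval]
    have : Λ * (t₂ - t₀) ≤ Λ * (t₂ - S.τ k) :=
      mul_le_mul_of_nonneg_left (by linarith [ht₀.1]) hΛ0.le
    linarith
  have hupp : ‖u t₀ x₀‖ ≤ B := by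
    rw [hval]
    have : 0 ≤ Λ * (t₂ - t₀) := mul_nonneg hΛ0.le (by linarith [ht₀.2])
    linarith
  have hstrict' : ∀ t' ∈ Ico 0 t₀, ∀ y, ‖u t' y‖ < ‖u t₀ x₀‖ := by
    intro t' ht' y
    refine lt_of_lt_of_le (hstrict t' ht' y) ?_
    rw [hval]
    have hm : Λ * max (t' - S.τ k) 0 ≤ Λ * (t₀ - S.τ k) :=
      mul_le_mul_of_nonneg_left (max_le (by linarith [ht'.2]) (by linarith [ht₀.1])) hΛ0.le
    linarith
  have hpush := h t₀ ht₀' x₀ hmax hlow hupp hstrict'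
  linarith

end Stage

/-- **`AprioriCeilingAt k` FROM A RATE BOUND ON THE PRESSURE PUSH** (`k ≥ 1`). If for every pinned rigid
quiet wide schedule, every registered level-`k` stage, every `T' ∈ [τ_k, τ_{k+1}]` and every
finite-energy classical continuation `(u, p)` on `[0, T']` (unit viscosity), at every `t ∈ (τ_k, T']`
and every global argmax `x` of the speed in the band `(c₂ Y_k, c₂ Y_{k+1}]` exceeding all earlier
speeds, the velocity-projected pressure push is SLOWER than the overshoot line:
`−⟪u, ∇p⟫ < |Du|²_F + c₂ (Y_{k+1} − Y_k)/(τ_{k+1} − τ_k) · ‖u‖`, then the a-priori ceiling holds. A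
strictly weaker hypothesis than the sign condition `0 < |Du|²_F + ⟪u, ∇p⟫` at first touchings of
`c₂ Y_{k+1}` (p442281 `aprioriCeilingAt_of_noPush`): the push may be positive, as long as it is slow.
At `k = 1` (item 19249): the rate is `(5/3)(Y₂ − Y₁)/(τ₂ − τ₁) ∈ (1.021, 1.022)·10⁸`.
[cite: Palasek2026ElementaryModel, §4] -/
theorem aprioriCeilingAt_of_pressureRate {k : ℕ} (hk : 1 ≤ k)
    (h : ∀ S : Schedule TowerRates.wide, S.Pins 8 (6 / 5) → S.Rigid → S.Quiet →
      ∀ s : Stage 1 TowerRates.wide S (Margins.routeG TowerRates.wide) k,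
      ∀ T' ∈ Icc (S.τ k) (S.τ (k + 1)),
      ∀ (u : ℝ → EuclideanSpace ℝ (Fin 3) → EuclideanSpace ℝ (Fin 3))
        (p : ℝ → EuclideanSpace ℝ (Fin 3) → ℝ),
        IsClassicalNSSolutionOn (Icc 0 T') 1 S.f u p →
        (∀ t ∈ Icc 0 (S.τ k), u t = s.u t ∧ p t = s.p t) →
        (∃ C : ℝ≥0∞, C < ⊤ ∧ ∀ t ∈ Icc 0 T', ∫⁻ x, ‖u t x‖ₑ ^ 2 ≤ C) →
        ∀ t ∈ Ioc (S.τ k) T', ∀ x : EuclideanSpace ℝ (Fin 3),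
          (∀ y, ‖u t y‖ ≤ ‖u t x‖) →
          S.c₂ * TowerRates.wide.Y k < ‖u t x‖ → ‖u t x‖ ≤ S.c₂ * TowerRates.wide.Y (k + 1) →
          (∀ t' ∈ Ico 0 t, ∀ y, ‖u t' y‖ < ‖u t x‖) →
          - ⟪u t x, gradient (p t) x⟫ < frobeniusNormSq (fderiv ℝ (u t) x) +
            (S.c₂ * TowerRates.wide.Y (k + 1) - S.c₂ * TowerRates.wide.Y k) / (S.τ (k + 1) - S.τ k) *
              ‖u t x‖) :
    AprioriCeilingAt k := by
  intro S hP hR hQ s T' hT' u p hcl hagree henergy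
  refine s.norm_le_ceiling_of_pressureRate one_pos hQ hk hT' hcl (fun t ht => (hagree t ht).1) henergy ?_
  intro t ht x hmax hlow hupp hstrict
  have := h S hP hR hQ s T' hT' u p hcl hagree henergy t ht x hmax hlow hupp hstrict
  rwa [one_mul]

/-- **`AprioriCeiling` (upper half of `HeredityFromTwo`, all `k ≥ 2`) FROM THE RATE BOUND at every
level**. [cite: Palasek2026ElementaryModel, §4] -/
theorem aprioriCeiling_of_pressureRate
    (h : ∀ S : Schedule TowerRates.wide, S.Pins 8 (6 / 5) → S.Rigid → S.Quiet → ∀ k : ℕ, 2 ≤ k →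
      ∀ s : Stage 1 TowerRates.wide S (Margins.routeG TowerRates.wide) k,
      ∀ T' ∈ Icc (S.τ k) (S.τ (k + 1)),
      ∀ (u : ℝ → EuclideanSpace ℝ (Fin 3) → EuclideanSpace ℝ (Fin 3))
        (p : ℝ → EuclideanSpace ℝ (Fin 3) → ℝ),
        IsClassicalNSSolutionOn (Icc 0 T') 1 S.f u p →
        (∀ t ∈ Icc 0 (S.τ k), u t = s.u t ∧ p t = s.p t) →
        (∃ C : ℝ≥0∞, C < ⊤ ∧ ∀ t ∈ Icc 0 T', ∫⁻ x, ‖u t x‖ₑ ^ 2 ≤ C) →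
        ∀ t ∈ Ioc (S.τ k) T', ∀ x : EuclideanSpace ℝ (Fin 3),
          (∀ y, ‖u t y‖ ≤ ‖u t x‖) →
          S.c₂ * TowerRates.wide.Y k < ‖u t x‖ → ‖u t x‖ ≤ S.c₂ * TowerRates.wide.Y (k + 1) →
          (∀ t' ∈ Ico 0 t, ∀ y, ‖u t' y‖ < ‖u t x‖) →
          - ⟪u t x, gradient (p t) x⟫ < frobeniusNormSq (fderiv ℝ (u t) x) +
            (S.c₂ * TowerRates.wide.Y (k + 1) - S.c₂ * TowerRates.wide.Y k) / (S.τ (k + 1) - S.τ k) *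
              ‖u t x‖) :
    AprioriCeiling := by
  intro S hP hR hQ k hk s T' hT' u p hcl hagree henergy
  refine s.norm_le_ceiling_of_pressureRate one_pos hQ (le_trans one_le_two hk) hT' hcl
    (fun t ht => (hagree t ht).1) henergy ?_
  intro t ht x hmax hlow hupp hstrict
  have := h S hP hR hQ k hk s T' hT' u p hcl hagree henergy t ht x hmax hlow hupp hstrict
  rwa [one_mul]

/-- **The overshoot rate of record at `k = 1`** (item 19249): on every rigid schedule on the wide rates
`c₂ (Y₂ − Y₁)/(τ₂ − τ₁) = (5/3)(Y₂ − Y₁) · A₁/((253/25) log N₂) ∈ (1.021·10⁸, 1.022·10⁸)`. [folklore] -/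
theorem Schedule.Rigid.overshootRate_one_bounds {S : Schedule TowerRates.wide} (h : S.Rigid) :
    (102100000 : ℝ) < (S.c₂ * TowerRates.wide.Y 2 - S.c₂ * TowerRates.wide.Y 1) / (S.τ 2 - S.τ 1) ∧
      (S.c₂ * TowerRates.wide.Y 2 - S.c₂ * TowerRates.wide.Y 1) / (S.τ 2 - S.τ 1) < 102200000 := by
  obtain ⟨hw1, hw2⟩ := h.window_one_bounds
  obtain ⟨hY1, hY1'⟩ := TowerRates.wide_Y_one_bounds
  obtain ⟨hY2, hY2'⟩ := TowerRates.wide_Y_two_bounds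
  have hw : 0 < S.τ 2 - S.τ 1 := by linarith
  rw [h.c₂_eq]
  constructor
  · rw [lt_div_iff₀ hw]; nlinarith
  · rw [div_lt_iff₀ hw]; nlinarith

/-- **`AprioriCeilingAt 1` from the NUMERICAL rate bound `1.021·10⁸`** (item 19249's upper stub, unit
viscosity): if at every running global speed maximum in the band `((5/3) Y₁, (5/3) Y₂] ⊂ (4630, 10234]`
of every finite-energy classical continuation of every registered level-1 stage of a pinned rigid quiet
wide schedule, exceeding all earlier speeds, the pressure push obeys
`−⟪u, ∇p⟫ < |Du|²_F + 1.021·10⁸ · ‖u‖`, then `AprioriCeilingAt 1`. [cite: Palasek2026ElementaryModel, §4] -/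
theorem aprioriCeilingAt_one_of_pressureRate_num
    (h : ∀ S : Schedule TowerRates.wide, S.Pins 8 (6 / 5) → S.Rigid → S.Quiet →
      ∀ s : Stage 1 TowerRates.wide S (Margins.routeG TowerRates.wide) 1,
      ∀ T' ∈ Icc (S.τ 1) (S.τ 2),
      ∀ (u : ℝ → EuclideanSpace ℝ (Fin 3) → EuclideanSpace ℝ (Fin 3))
        (p : ℝ → EuclideanSpace ℝ (Fin 3) → ℝ),
        IsClassicalNSSolutionOn (Icc 0 T') 1 S.f u p →
        (∀ t ∈ Icc 0 (S.τ 1), u t = s.u t ∧ p t = s.p t) →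
        (∃ C : ℝ≥0∞, C < ⊤ ∧ ∀ t ∈ Icc 0 T', ∫⁻ x, ‖u t x‖ₑ ^ 2 ≤ C) →
        ∀ t ∈ Ioc (S.τ 1) T', ∀ x : EuclideanSpace ℝ (Fin 3),
          (∀ y, ‖u t y‖ ≤ ‖u t x‖) →
          S.c₂ * TowerRates.wide.Y 1 < ‖u t x‖ → ‖u t x‖ ≤ S.c₂ * TowerRates.wide.Y 2 →
          (∀ t' ∈ Ico 0 t, ∀ y, ‖u t' y‖ < ‖u t x‖) →
          - ⟪u t x, gradient (p t) x⟫ < frobeniusNormSq (fderiv ℝ (u t) x) + 102100000 * ‖u t x‖) :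
    AprioriCeilingAt 1 := by
  refine aprioriCeilingAt_of_pressureRate le_rfl ?_
  intro S hP hR hQ s T' hT' u p hcl hagree henergy t ht x hmax hlow hupp hstrict
  have h1 := h S hP hR hQ s T' hT' u p hcl hagree henergy t ht x hmax hlow hupp hstrict
  obtain ⟨hrate, -⟩ := hR.overshootRate_one_bounds
  have hpos : 0 ≤ ‖u t x‖ := norm_nonneg _
  have : (102100000 : ℝ) * ‖u t x‖ ≤
      (S.c₂ * TowerRates.wide.Y (1 + 1) - S.c₂ * TowerRates.wide.Y 1) / (S.τ (1 + 1) - S.τ 1) *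
        ‖u t x‖ := by
    rw [show (1 : ℕ) + 1 = 2 from rfl]
    exact mul_le_mul_of_nonneg_right hrate.le hpos
  linarith

end Summit.NavierStokesRegularity.FluidComputer.PalasekTowerClayBridge

end
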